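import Mathlib.Geometry.Manifold.MFDeriv.Atlas
import Mathlib.Geometry.Manifold.IntegralCurve.Transform
import Literature.Geometry.Lorentzian.Stationary
import Literature.Geometry.Lorentzian.Einstein
import Literature.Geometry.Lorentzian.ConvergenceTransport
import HarnessLib

/-!
# The moduli space of regular stationary vacuum black holes, I: points, equivalence, quotient,
level map

Definition request `defn-StationaryVacuumModuli` of route `FinalStateConjecture/SignedCensus`
(topic `Geometry/Lorentzian`; wanted as the layer-2 object of its items `OpenUnderRotation`,
`ClosedUnderRotation`, `CensusUniqueness`). The request was split, as it allows, into
(i) setoid + quotient + level map (this file) and (ii) topology + Kerr locus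
(`StationaryVacuumModuliTopology`).

## Contents (namespace `Literature.Geometry.Lorentzian`)

* `IsFlowInvariant V S` — `S` is invariant under the whole-line integral curves of `V`.
* `StationaryAFBlackHole.IsRegularVacuum 𝓑` — the POINTS: a stationary asymptotically flat
  black hole `𝓑 : StationaryAFBlackHole` (`Stationary.lean`: `C^∞` spacetime, slice with an AF
  end, complete stationary Killing field `T` timelike on `M_ext`) satisfying, verbatim and in the
  same order, the regularity hypotheses of the route's rev-3 items (carrier globally hyperbolic,
  the embedded slice a Cauchy hypersurface in the corrected sense `IsCauchyHypersurface` — the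
  rev-2 clause `IsCauchySurface` being uninhabited, `IsCauchySurface.isEmpty` —, `𝓔⁺` connected and
  non-degenerate, `g(T,T) → −1` along the end) and the vacuum equations `Ric(g) = 0`
  (`isRegularVacuum_iff`).
* `StationaryAFBlackHole.killingNormSq`, `StationaryAFBlackHole.level 𝓑 = sSup_{𝓔⁺} g(T,T)` —
  the horizon rotation level (`level_le_iff`: `level ≤ s ↔ ∀ p ∈ 𝓔⁺, g_p(T,T) ≤ s` under
  boundedness, the graded hypothesis of the route).
* `StationaryAFBlackHole.ModuliEquivalence 𝓑 𝓑'` — the data identifying two points: an open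
  partial homeomorphism `ψ : U → U'` (Mathlib `OpenPartialHomeomorph`), `C^∞` both ways, with
  `U ⊇ ⟨⟨M_ext⟩⟩ ∪ 𝓔⁺`, `U' ⊇ ⟨⟨M'_ext⟩⟩ ∪ 𝓔'⁺` invariant under the Killing flows, identifying
  d.o.c.s and horizons (`IsImage`), with `ψ^* g' = λ² g` (isometry composed with the homothety of
  scale `λ > 0`), `dψ T = λ T' ∘ ψ` (intertwining of the NORMALISED Killing fields) and preserving
  time orientation; `refl`, `symm`, `trans` are constructed (so no relation is postulated to be an
  equivalence: it is proved), and `killingNormSq_eq`, `image_horizon`, `image_doc`, `level_eq`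
  (the level is a class invariant).
* `StationaryAFBlackHole.IsModuliEquivalent` (`Nonempty (ModuliEquivalence 𝓑 𝓑')`, an
  equivalence relation), `RegularStationaryVacuumBlackHole` (the subtype) with its `Setoid`,
  **`StationaryVacuumModuli := Quotient …`** (the moduli space `𝔐`, in `Type (u+1)`),
  `StationaryVacuumModuli.mk / mk_eq_mk_iff / ind / exists_rep`, the level map
  `StationaryVacuumModuli.level : 𝔐 → ℝ` (`Quotient.lift`, `level_mk`), `sublevel s`.

## Sources and modelling

The moduli space is modelled on the moduli spaces of stationary / static vacuum solutions
modulo diffeomorphisms of Anderson (Ann. Henri Poincaré 1 (2000) 977, §1.3: "we need to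
understand aspects of the moduli space of stationary solutions", Lemma 1.3: convergence "in the
`C^∞` topology, modulo diffeomorphisms", potentials renormalised by scalars) and Anderson–Khuri
(arXiv:0909.4550, §1 and Thm. 3.6: `𝓔_S = 𝔼_S^{m,α}/𝒟₁`, a smooth Banach manifold on which the
boundary map is Fredholm of index `0`) — with two differences forced by the request: the points
are black-hole exteriors-with-horizon whose underlying manifolds vary (each
`StationaryAFBlackHole` carries its own carrier), so "modulo diffeomorphisms" becomes "modulo
isometries between `T`-invariant neighbourhoods of `⟨⟨M_ext⟩⟩ ∪ 𝓔⁺`" (the identification under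
which the uniqueness theorems are stated: Chruściel–Costa, Astérisque 321 (2008), Thm. 1.3;
Chruściel–Costa–Heusler 2012, §3); and homotheties `g ↦ λ² g` are quotiented out (the vacuum
equations, the normalisation `g(T,T) → −1` and the level are scale invariant; Kerr
`(M, a) ∼ (λM, λa)`, so that the Kerr family is the curve `a/M`). The level is the smallness
parameter `‖g(T,T)‖_{L^∞(S₀)}` of Alexakis–Ionescu–Klainerman (Duke Math. J. 163 (2014),
Thm. 1.1), taken over the whole future event horizon as in the route.

## Design choices

* **Why `T' ∘ ψ = λ⁻¹ dψ T`.** Under `g' = λ² g` the Killing field normalised by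
  `g'(T',T') → −1` is `T' = λ⁻¹ T`; hence an isometry-up-to-scale `ψ^* g' = λ² g` must satisfy
  `dψ T = λ T'`. Then `g'(T',T') ∘ ψ = g(T,T)` (`ModuliEquivalence.killingNormSq_eq`): the level
  is scale-free.
* **Horizons and d.o.c.s are identified exactly** (`IsImage`), and `U`, `U'` are flow-invariant
  open sets containing `⟨⟨M_ext⟩⟩ ∪ 𝓔⁺`: this is what "isometry between `T`-invariant
  neighbourhoods of (d.o.c. ∪ future event horizon)" must mean for the relation to be transitive
  (composites are defined on `U ∩ ψ⁻¹(V) ⊇ ⟨⟨M_ext⟩⟩ ∪ 𝓔⁺`, flow-invariant because `ψ` maps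
  `T`-orbits to reparametrised `T'`-orbits, `ModuliEquivalence.isMIntegralCurve_comp`) and for the
  level to be well defined. `𝓔⁺`, `⟨⟨M_ext⟩⟩` are the GLOBAL causal objects of `Stationary.lean`
  (`𝓑.horizon`, `𝓑.doc`), not recomputed inside `U`. Time orientation is required to be
  preserved (an isometry of time-oriented spacetimes; automatic where `T`, `T'` are both
  future timelike). Both flow-invariance clauses and both inclusion clauses are carried as fields
  (the data are symmetric; each is one line to check in examples).
* **The slice is not part of the geometry of a class**: two regular black holes with different
  Cauchy slices / AF end charts but isometric neighbourhoods of `⟨⟨M_ext⟩⟩ ∪ 𝓔⁺` are the same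
  point. The slice enters only through `IsRegularVacuum` (Cauchy hypersurface, normalisation
  along its end).
* **`level` is real-valued** (`sSup`, junk `0` on empty/unbounded sets, documented) as requested
  ("values in `[0, ∞)`"); nonnegativity (`T` is tangent to the null hypersurface `𝓔⁺`, hence
  spacelike or null there) and boundedness are theorems about regular holes, not built in.
* **Universe.** `StationaryAFBlackHole.{u} : Type (u+1)`, so `𝔐 = StationaryVacuumModuli.{u} :
  Type (u+1)`; the route's abstract `CensusUniqueness` quantifies over `𝔐 B : Type` and must be
  instantiated universe-polymorphically (a remark for the planner; nothing here depends on it).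
* **No non-emptiness is claimed.** Whether sub-extremal Kerr (ingoing chart `{r > r₊ − δ}` with a
  horizon-crossing bent Cauchy slice) is a regular stationary vacuum black hole in the above sense
  is the route's "cheapest falsifier (i)" (no item id at rev 3) — a theorem about
  `Kerr.stationaryAFBlackHole` (`KerrStationaryBlackHole.lean`; its slice `{t* = 0}` is NOT a
  Cauchy hypersurface of `{r > r₊ − δ}`), not part of this definition. The Kerr locus of `𝔐` is defined in part II through
  `ModuliEquivalence` to the Kerr chart, which does not need the Kerr side to be regular.

## Mathlib / tree

Mathlib has no Lorentzian geometry; used: `OpenPartialHomeomorph` (`IsImage`, `trans`, `symm`),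
`OpenPartialHomeomorph.MDifferentiable` (`symm_comp_deriv`, `mfderiv_injective`,
`MFDeriv/Atlas`), `IsMIntegralCurve.comp_mul/comp_add` (`IntegralCurve/Transform`), `Quotient`,
`Setoid`, `Real.sSup`. From the tree: `StationaryAFBlackHole`, `.doc`, `.horizon`, `.Mext`,
`Spacetime.IsNonDegenerateHorizon` (`Stationary`), `IsGloballyHyperbolic`, `IsCauchySurface`
(`Causality`), `IsRicciFlat` (`Einstein`), `pullbackBilin` (`Isometry`),
`TimeOrientation.isFutureDirected_of_val_lt_zero` (`ConvergenceTransport`). `lean search`: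
no `moduli`/`Moduli` declaration for Lorentzian metrics or black holes exists in Mathlib or the
tree (`TeichmullerModuli`-type files concern Riemann surfaces).

## References

* M. T. Anderson, *On stationary vacuum solutions to the Einstein equations*, Ann. Henri
  Poincaré 1 (2000) 977–994, gr-qc/0001091, §1.3, Lemmas 1.3–1.4 (key `Anderson2000`).
* M. T. Anderson, M. A. Khuri, *The static extension problem in general relativity*,
  arXiv:0909.4550 = Class. Quantum Grav. 30 (2013) 125005, §1, §3, Thm. 3.6 (key
  `AndersonKhuri2009`).
* S. Alexakis, A. D. Ionescu, S. Klainerman, *Rigidity of stationary black holes with small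
  angular momentum on the horizon*, Duke Math. J. 163 (2014), arXiv:1304.0487, Thm. 1.1 (key
  `AlexakisIonescuKlainerman2014`).
* P. T. Chruściel, J. L. Costa, Astérisque 321 (2008), arXiv:0806.0016, §2, Thm. 1.3 (key
  `ChruscielCosta2008`); P. T. Chruściel, J. L. Costa, M. Heusler, Living Rev. Relativ. 15
  (2012), arXiv:1205.6112, §3 (key `ChruscielCostaHeusler2012`).
* B. O'Neill, *Semi-Riemannian geometry*, Academic Press 1983, Ch. 3 (isometries, homotheties
  p. 92), Ch. 5, Lemma 5.29 (timecones), Ch. 9 (Killing fields) (key `ONeillSemiRiemannian1983`).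
-/

noncomputable section

open Bundle Set Manifold TopologicalSpace Filter
open scoped ContDiff Topology Manifold

universe u

namespace Literature.Geometry.Lorentzian

/-! ### Flow-invariant sets -/

section FlowInvariant

variable {E : Type*} [NormedAddCommGroup E] [NormedSpace ℝ E] {H : Type*} [TopologicalSpace H]
  {I : ModelWithCorners ℝ E H} {M : Type*} [TopologicalSpace M] [ChartedSpace H M]

/-- A set `S ⊆ M` is **invariant under the flow of the vector field `V`** if every whole-line
integral curve of `V` (`IsMIntegralCurve`) starting in `S` stays in `S` for all times. For a
complete `V` (all maximal integral curves are whole-line, `IsCompleteVectorField`) this is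
invariance of `S` under the one-parameter group `φₜ` of `V`; it is the tangency clause of
`LorentzianMetric.IsNonDegenerateHorizon` (`Stationary.lean`) as a predicate on sets.
O'Neill 1983, Ch. 1, Def. 1.52 ff. (flows of complete vector fields). [folklore] -/
def IsFlowInvariant (V : Π x : M, TangentSpace I x) (S : Set M) : Prop :=
  ∀ γ : ℝ → M, IsMIntegralCurve γ V → γ 0 ∈ S → ∀ t, γ t ∈ S

/-- The whole manifold is invariant under every flow. [folklore] -/
lemma isFlowInvariant_univ (V : Π x : M, TangentSpace I x) : IsFlowInvariant V (univ : Set M) :=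
  fun _ _ _ _ ↦ mem_univ _

/-- The intersection of two flow-invariant sets is flow-invariant. [folklore] -/
lemma IsFlowInvariant.inter {V : Π x : M, TangentSpace I x} {S T : Set M}
    (hS : IsFlowInvariant V S) (hT : IsFlowInvariant V T) : IsFlowInvariant V (S ∩ T) :=
  fun γ hγ h0 t ↦ ⟨hS γ hγ h0.1 t, hT γ hγ h0.2 t⟩

/-- If a whole-line integral curve of `V` meets a flow-invariant set `S` at some time `t₀`, it
lies in `S` at all times (reparametrise by the time translation `t ↦ t + t₀`,
`IsMIntegralCurve.comp_add`). [folklore] -/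
lemma IsFlowInvariant.mem_of_mem {V : Π x : M, TangentSpace I x} {S : Set M}
    (hS : IsFlowInvariant V S) {γ : ℝ → M} (hγ : IsMIntegralCurve γ V) {t₀ : ℝ} (h0 : γ t₀ ∈ S)
    (t : ℝ) : γ t ∈ S := by
  have h := hS (γ ∘ (· + t₀)) (hγ.comp_add t₀) (by simpa using h0) (t - t₀)
  simpa using h

end FlowInvariant

namespace StationaryAFBlackHole

variable (𝓑 : StationaryAFBlackHole.{u})

/-! ### The points: regular stationary vacuum black holes -/

/-- A stationary asymptotically flat black hole `𝓑` (hypothesis structure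
`StationaryAFBlackHole`: a `C^∞` spacetime, a slice with an AF end, a complete stationary Killing
field `T = 𝓑.killing` timelike near infinity) is a **regular stationary vacuum black hole** — a
point of the moduli space `StationaryVacuumModuli` — if it satisfies the hypotheses common to the
items `GradedNoHair` (stmt-FinalStateConjecture-10824), `ClosedUnderRotation` (…-10825),
`OpenUnderRotation` (…-10826), `StaticAnchor` (…-10827) of route `FinalStateConjecture/SignedCensus`
at its rev 3 (where they are written as a chain of hypotheses over `𝓑`), minus the level bound:
* the carrier is globally hyperbolic (`IsGloballyHyperbolic`) and the embedded slice is a Cauchy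
  hypersurface in the CORRECTED sense `LorentzianMetric.IsCauchyHypersurface` (met exactly once by
  every endless timelike curve; O'Neill 1983, Def. 14.28) — not the uninhabited rev-2 clause
  `IsCauchySurface` (`IsCauchySurface.isEmpty`, `CausalityProofs`);
* the future event horizon `𝓔⁺ = 𝓑.horizon` is connected (hence nonempty) and non-degenerate
  (`Spacetime.IsNonDegenerateHorizon`, under the standing Levi-Civita instance);
* `T` is normalised at infinity: `g(T, T) → −1` along the AF end (filter `⨅ R, 𝓟 (e.far R)`);
* `Ric(g) = 0` (`PseudoRiemannianMetric.IsRicciFlat`, under the standing Levi-Civita instance).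
The fields are these hypotheses in the route's order (`isRegularVacuum_iff`); the route's remaining
binders `[Kerr.Facts] (hF) (hP)` concern its conclusion (the Kerr exterior chart, `docOpens`) and are
not properties of `𝓑`. No analyticity, axisymmetry or closeness to Kerr is assumed
(Chruściel–Costa–Heusler, Living Rev. Relativ. 15 (2012), §3.3–3.4; Ionescu–Klainerman,
arXiv:1501.01587, §4). **Joint satisfiability** is not proved in the tree: the intended witness is
sub-extremal Kerr in the ingoing chart `{r > r₊ − δ}` with a horizon-crossing bent slice
`{t* + f(r) = 0}` (the route's "cheapest falsifier (i)", checked by hand there; no item id yet at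
rev 3), and each clause separately is a standard property of that spacetime — none is refuted by a
tree lemma (both causal clauses are inhabited: `Minkowski.isGloballyHyperbolic`,
`Minkowski.isCauchyHypersurface_range_sliceEmbed`). [folklore] -/
structure IsRegularVacuum : Prop where
  /-- The carrier is globally hyperbolic. -/
  isGloballyHyperbolic : 𝓑.metric.IsGloballyHyperbolic 𝓑.timeOrientation
  /-- The embedded slice is a Cauchy hypersurface of the carrier (the corrected notion
  `LorentzianMetric.IsCauchyHypersurface` — met exactly once by every ENDLESS timelike curve; the
  older `IsCauchySurface` is uninhabited on nonempty manifolds, `IsCauchySurface.isEmpty` in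
  `CausalityProofs`, and was removed from the route at its rev 3). -/
  isCauchyHypersurface : 𝓑.metric.IsCauchyHypersurface 𝓑.timeOrientation (Set.range 𝓑.embed)
  /-- The future event horizon is connected. -/
  isConnected_horizon : IsConnected 𝓑.horizon
  /-- The future event horizon is a non-degenerate Killing horizon. -/
  isNonDegenerateHorizon : ∀ [𝓑.metric.HasLeviCivita], 𝓑.toSpacetime.IsNonDegenerateHorizon 𝓑.Mext
  /-- The stationary Killing field is normalised: `g(T, T) → −1` along the end. -/
  tendsto_killingNormSq : Tendsto
    (fun x ↦ 𝓑.metric.val (𝓑.embed x) (𝓑.killing (𝓑.embed x)) (𝓑.killing (𝓑.embed x)))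
    (⨅ R : ℝ, 𝓟 (𝓑.e.far R)) (𝓝 (-1))
  /-- The vacuum equations `Ric(g) = 0`. -/
  isRicciFlat : ∀ [𝓑.metric.HasLeviCivita], 𝓑.metric.toPseudoRiemannianMetric.IsRicciFlat

/-- Unfolding lemma: `IsRegularVacuum` is the conjunction of the regularity hypotheses of the
rev-3 items of route `FinalStateConjecture/SignedCensus` (global hyperbolicity, Cauchy
HYPERsurface slice, connected non-degenerate horizon, normalised Killing field — in this order) and
the vacuum equations. [folklore] -/
theorem isRegularVacuum_iff : 𝓑.IsRegularVacuum ↔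
    (𝓑.metric.IsGloballyHyperbolic 𝓑.timeOrientation ∧
      𝓑.metric.IsCauchyHypersurface 𝓑.timeOrientation (Set.range 𝓑.embed) ∧
      IsConnected 𝓑.horizon ∧
      (∀ [𝓑.metric.HasLeviCivita], 𝓑.toSpacetime.IsNonDegenerateHorizon 𝓑.Mext) ∧
      Tendsto (fun x ↦ 𝓑.metric.val (𝓑.embed x) (𝓑.killing (𝓑.embed x)) (𝓑.killing (𝓑.embed x)))
        (⨅ R : ℝ, 𝓟 (𝓑.e.far R)) (𝓝 (-1))) ∧
    ∀ [𝓑.metric.HasLeviCivita], 𝓑.metric.toPseudoRiemannianMetric.IsRicciFlat :=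
  ⟨fun h ↦ ⟨⟨h.1, h.2, h.3, h.4, h.5⟩, h.6⟩, fun h ↦ ⟨h.1.1, h.1.2.1, h.1.2.2.1, h.1.2.2.2.1,
    h.1.2.2.2.2, h.2⟩⟩

/-- A regular stationary vacuum black hole has a nonempty horizon (it is connected). [folklore] -/
lemma IsRegularVacuum.horizon_nonempty {𝓑 : StationaryAFBlackHole.{u}} (h : 𝓑.IsRegularVacuum) :
    𝓑.horizon.Nonempty :=
  h.isConnected_horizon.nonempty

/-! ### The level: horizon rotation `sup_{𝓔⁺} g(T, T)` -/

/-- The squared norm `g_p(T, T)` of the stationary Killing field at `p` (negative where `T` is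
timelike, e.g. on `M_ext`; nonnegative on the horizon, to which `T` is tangent). Alexakis–
Ionescu–Klainerman, Duke Math. J. 163 (2014) = arXiv:1304.0487, Thm. 1.1 (whose smallness
hypothesis is `‖g(T,T)‖_{L^∞(S₀)} < ε²` on the bifurcation sphere `S₀`). [cite: AlexakisIonescuKlainerman2014, Thm. 1.1] -/
def killingNormSq (p : 𝓑.carrier) : ℝ :=
  𝓑.metric.val p (𝓑.killing p) (𝓑.killing p)

/-- Unfolding lemma for `killingNormSq`. [folklore] -/
@[simp]
lemma killingNormSq_apply (p : 𝓑.carrier) :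
    𝓑.killingNormSq p = 𝓑.metric.val p (𝓑.killing p) (𝓑.killing p) :=
  rfl

/-- Transport of the Killing vector along an equality of base points (the tangent spaces of the
carrier are all the model space `E4`, so the two values can be compared there). [folklore] -/
theorem killing_congr {p q : 𝓑.carrier} (e : p = q) : (𝓑.killing p : E4) = 𝓑.killing q := by
  subst e
  rfl

/-- The **(horizon rotation) level** of a stationary black hole: `sSup {g_p(T, T) | p ∈ 𝓔⁺}`, the
supremum over the future event horizon of the squared norm of the normalised stationary Killing
field (`0` for a horizon on which `T` is null — a non-rotating horizon; `a²/r₊² ∈ [0, 1)` for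
Kerr with `T = ∂_{t*}`; it is exactly the smallness parameter of Alexakis–Ionescu–Klainerman
2014, Thm. 1.1, taken over all of `𝓔⁺`). Real-valued `sSup`: **junk value `0`** if the horizon is empty or
`g(T,T)` is unbounded above on it (`Real.sSup` conventions); on regular black holes the horizon is
nonempty, and `level_le_iff` is stated under `BddAbove`. Invariant under the equivalence of the
moduli space (`ModuliEquivalence.level_eq`), so that it descends to `StationaryVacuumModuli.level`.
[cite: AlexakisIonescuKlainerman2014, Thm. 1.1] -/
def level : ℝ :=
  sSup (𝓑.killingNormSq '' 𝓑.horizon)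

/-- For a nonempty horizon on which `g(T, T)` is bounded above, `level 𝓑 ≤ s` iff
`g_p(T, T) ≤ s` at every horizon point — the graded hypothesis "level at most `s`" of route
`FinalStateConjecture/SignedCensus` (`csSup_le_iff`). [folklore] -/
theorem level_le_iff {s : ℝ} (hne : 𝓑.horizon.Nonempty)
    (hbdd : BddAbove (𝓑.killingNormSq '' 𝓑.horizon)) :
    𝓑.level ≤ s ↔ ∀ p ∈ 𝓑.horizon, 𝓑.metric.val p (𝓑.killing p) (𝓑.killing p) ≤ s := by
  rw [level, csSup_le_iff hbdd (hne.image _)]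
  simp

/-- `g_p(T, T) ≤ level 𝓑` at every horizon point, when `g(T,T)` is bounded above on the horizon
(`le_csSup`). [folklore] -/
theorem killingNormSq_le_level {p : 𝓑.carrier} (hp : p ∈ 𝓑.horizon)
    (hbdd : BddAbove (𝓑.killingNormSq '' 𝓑.horizon)) : 𝓑.killingNormSq p ≤ 𝓑.level :=
  le_csSup hbdd (mem_image_of_mem _ hp)

/-! ### The equivalence: isometry of `T`-invariant neighbourhoods of `⟨⟨M_ext⟩⟩ ∪ 𝓔⁺` composed
with a homothety -/

/-- An **equivalence of stationary black holes** `𝓑 → 𝓑'` **with scale `λ > 0`**: the data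
identifying two points of the moduli space `StationaryVacuumModuli`. It consists of a homeomorphism
`ψ` between OPEN sets `U = ψ.source ⊆ M` and `U' = ψ.target ⊆ M'` (an `OpenPartialHomeomorph`),
`C^∞` in both directions, such that
* `U ⊇ ⟨⟨M_ext⟩⟩ ∪ 𝓔⁺` and `U' ⊇ ⟨⟨M'_ext⟩⟩ ∪ 𝓔'⁺` are invariant under the flows of the
  stationary Killing fields `T`, `T'` (`IsFlowInvariant`);
* `ψ` identifies the domains of outer communications and the future event horizons:
  `ψ(U ∩ ⟨⟨M_ext⟩⟩) = U' ∩ ⟨⟨M'_ext⟩⟩`, `ψ(U ∩ 𝓔⁺) = U' ∩ 𝓔'⁺` (`OpenPartialHomeomorph.IsImage`);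
* `ψ` is an **isometry composed with the homothety `g ↦ λ² g`**: `ψ^* g' = λ² g` on `U`
  (`pullbackBilin`);
* `ψ` **intertwines the normalised Killing fields**: `dψ (T) = λ T' ∘ ψ` on `U` (the homothety
  `g ↦ λ² g` rescales the Killing field normalised by `g(T,T) → −1` at infinity to `λ⁻¹ T`, so
  `ψ^* T' = λ⁻¹ T` is the correct intertwining; `g'(T',T') ∘ ψ = g(T,T)`,
  `ModuliEquivalence.killingNormSq_eq`);
* `ψ` preserves the time orientations.
For `λ = 1` this is an isometry of `T`-invariant neighbourhoods of `⟨⟨M_ext⟩⟩ ∪ 𝓔⁺` intertwining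
the stationary Killing fields (the identification under which uniqueness theorems are stated:
Chruściel–Costa, Astérisque 321 (2008), Thm. 1.3, "`⟨⟨M_ext⟩⟩` is isometric to the domain of outer
communications of a Kerr space-time"; Chruściel–Costa–Heusler 2012, §3.4); the scale implements
"modulo homotheties" (the vacuum equations, the normalisation of `T` and the level are
scale-invariant; Kerr `(M, a) ∼ (λM, λa)`). `refl`, `symm`, `trans` below make
`Nonempty (ModuliEquivalence 𝓑 𝓑')` an equivalence relation. [folklore] -/
structure ModuliEquivalence (𝓑 𝓑' : StationaryAFBlackHole.{u}) where
  /-- The identification `ψ : U → U'` as an open partial homeomorphism `M ⇀ M'`. -/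
  toOpenPartialHomeomorph : OpenPartialHomeomorph 𝓑.carrier 𝓑'.carrier
  /-- The scale `λ` of the homothety. -/
  scale : ℝ
  /-- The scale is positive. -/
  scale_pos : 0 < scale
  /-- `ψ` is smooth on `U`. -/
  contMDiffOn : ContMDiffOn (𝓡 4) (𝓡 4) ∞ toOpenPartialHomeomorph toOpenPartialHomeomorph.source
  /-- `ψ⁻¹` is smooth on `U'`. -/
  contMDiffOn_symm :
    ContMDiffOn (𝓡 4) (𝓡 4) ∞ toOpenPartialHomeomorph.symm toOpenPartialHomeomorph.target
  /-- `U ⊇ ⟨⟨M_ext⟩⟩ ∪ 𝓔⁺`. -/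
  doc_union_horizon_subset_source : 𝓑.doc ∪ 𝓑.horizon ⊆ toOpenPartialHomeomorph.source
  /-- `U' ⊇ ⟨⟨M'_ext⟩⟩ ∪ 𝓔'⁺`. -/
  doc_union_horizon_subset_target : 𝓑'.doc ∪ 𝓑'.horizon ⊆ toOpenPartialHomeomorph.target
  /-- `U` is invariant under the flow of `T`. -/
  isFlowInvariant_source : IsFlowInvariant 𝓑.killing toOpenPartialHomeomorph.source
  /-- `U'` is invariant under the flow of `T'`. -/
  isFlowInvariant_target : IsFlowInvariant 𝓑'.killing toOpenPartialHomeomorph.target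
  /-- `ψ` identifies the domains of outer communications. -/
  isImage_doc : toOpenPartialHomeomorph.IsImage 𝓑.doc 𝓑'.doc
  /-- `ψ` identifies the future event horizons. -/
  isImage_horizon : toOpenPartialHomeomorph.IsImage 𝓑.horizon 𝓑'.horizon
  /-- `ψ^* g' = λ² g` on `U`. -/
  pullbackBilin_eq : ∀ x ∈ toOpenPartialHomeomorph.source,
    pullbackBilin (I := 𝓡 4) (I' := 𝓡 4) toOpenPartialHomeomorph 𝓑'.metric.val x =
      scale ^ 2 • 𝓑.metric.val x
  /-- `dψ T = λ T' ∘ ψ` on `U`. -/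
  mfderiv_killing : ∀ x ∈ toOpenPartialHomeomorph.source,
    mfderiv (𝓡 4) (𝓡 4) toOpenPartialHomeomorph x (𝓑.killing x) =
      scale • 𝓑'.killing (toOpenPartialHomeomorph x)
  /-- `ψ` preserves the time orientations on `U`. -/
  isFutureDirected : ∀ x ∈ toOpenPartialHomeomorph.source,
    𝓑'.timeOrientation.IsFutureDirected
      (mfderiv (𝓡 4) (𝓡 4) toOpenPartialHomeomorph x (𝓑.timeOrientation.vectorField x))

namespace ModuliEquivalence

variable {𝓑} {𝓑' 𝓑'' : StationaryAFBlackHole.{u}} (h : ModuliEquivalence 𝓑 𝓑')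

/-- `∞ ≠ 0` in `ℕ∞ω` (side condition of `ContMDiffOn.mdifferentiableOn`). [folklore] -/
private lemma infty_ne_zero : (∞ : ℕ∞ω) ≠ 0 := by decide

/-- An equivalence is differentiable in both directions (Mathlib's
`OpenPartialHomeomorph.MDifferentiable`), being `C^∞` in both directions. [folklore] -/
theorem mdifferentiable : h.toOpenPartialHomeomorph.MDifferentiable (𝓡 4) (𝓡 4) :=
  ⟨h.contMDiffOn.mdifferentiableOn infty_ne_zero,
    h.contMDiffOn_symm.mdifferentiableOn infty_ne_zero⟩

/-- Pointwise form of `ψ^* g' = λ² g`: `g'(dψ v, dψ w) = λ² g(v, w)`. [folklore] -/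
theorem val_mfderiv_mfderiv {x : 𝓑.carrier} (hx : x ∈ h.toOpenPartialHomeomorph.source)
    (v w : TangentSpace (𝓡 4) x) :
    𝓑'.metric.val (h.toOpenPartialHomeomorph x)
        (mfderiv (𝓡 4) (𝓡 4) h.toOpenPartialHomeomorph x v)
        (mfderiv (𝓡 4) (𝓡 4) h.toOpenPartialHomeomorph x w) =
      h.scale ^ 2 * 𝓑.metric.val x v w := by
  have := congrArg (fun B ↦ B v w) (h.pullbackBilin_eq x hx)
  simpa [pullbackBilin_apply] using this

/-- **The level integrand is invariant**: `g'(T', T')(ψ x) = g(T, T)(x)` on `U` (from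
`ψ^* g' = λ² g` and `dψ T = λ T'`: `λ² g'(T',T') ∘ ψ = g'(dψ T, dψ T) = λ² g(T,T)`). [folklore] -/
theorem killingNormSq_eq {x : 𝓑.carrier} (hx : x ∈ h.toOpenPartialHomeomorph.source) :
    𝓑'.killingNormSq (h.toOpenPartialHomeomorph x) = 𝓑.killingNormSq x := by
  have h1 := h.val_mfderiv_mfderiv hx (𝓑.killing x) (𝓑.killing x)
  rw [h.mfderiv_killing x hx] at h1
  simp only [map_smul, smul_apply, smul_eq_mul] at h1
  have hs : h.scale ^ 2 ≠ 0 := pow_ne_zero 2 h.scale_pos.ne'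
  simp only [killingNormSq_apply]
  have : h.scale ^ 2 * 𝓑'.metric.val (h.toOpenPartialHomeomorph x)
      (𝓑'.killing (h.toOpenPartialHomeomorph x)) (𝓑'.killing (h.toOpenPartialHomeomorph x)) =
      h.scale ^ 2 * 𝓑.metric.val x (𝓑.killing x) (𝓑.killing x) := by
    rw [← h1]; ring
  exact mul_left_cancel₀ hs this

/-- An equivalence maps the horizon of `𝓑` ONTO the horizon of `𝓑'`. [folklore] -/
theorem image_horizon : h.toOpenPartialHomeomorph '' 𝓑.horizon = 𝓑'.horizon := by
  have h1 := h.isImage_horizon.image_eq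
  rw [inter_eq_right.2 (subset_union_right.trans h.doc_union_horizon_subset_source),
    inter_eq_right.2 (subset_union_right.trans h.doc_union_horizon_subset_target)] at h1
  exact h1

/-- An equivalence maps the domain of outer communications of `𝓑` ONTO that of `𝓑'`. [folklore] -/
theorem image_doc : h.toOpenPartialHomeomorph '' 𝓑.doc = 𝓑'.doc := by
  have h1 := h.isImage_doc.image_eq
  rw [inter_eq_right.2 (subset_union_left.trans h.doc_union_horizon_subset_source),
    inter_eq_right.2 (subset_union_left.trans h.doc_union_horizon_subset_target)] at h1
  exact h1

/-- **The set of horizon values of `g(T,T)` is invariant** under equivalence. [folklore] -/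
theorem image_killingNormSq_horizon (h : ModuliEquivalence 𝓑 𝓑') :
    𝓑'.killingNormSq '' 𝓑'.horizon = 𝓑.killingNormSq '' 𝓑.horizon := by
  rw [← h.image_horizon, image_image]
  refine image_congr fun x hx ↦ h.killingNormSq_eq ?_
  exact h.doc_union_horizon_subset_source (Or.inr hx)

/-- **The level is an invariant of the equivalence class**: `level 𝓑 = level 𝓑'` whenever
`𝓑 ∼ 𝓑'` (isometries preserve `g(T,T)`; homotheties `g ↦ λ² g`, `T ↦ λ⁻¹ T` too). This is
what makes the level map on the moduli space well defined. [folklore] -/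
theorem level_eq (h : ModuliEquivalence 𝓑 𝓑') : 𝓑.level = 𝓑'.level := by
  rw [level, level, h.image_killingNormSq_horizon]

/-! #### Reflexivity, symmetry, transitivity -/

variable (𝓑) in
/-- **Reflexivity**: the identity of `M` with scale `1`. [folklore] -/
def refl : ModuliEquivalence 𝓑 𝓑 where
  toOpenPartialHomeomorph := OpenPartialHomeomorph.refl 𝓑.carrier
  scale := 1
  scale_pos := one_pos
  contMDiffOn := contMDiff_id.contMDiffOn
  contMDiffOn_symm := contMDiff_id.contMDiffOn
  doc_union_horizon_subset_source := subset_univ _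
  doc_union_horizon_subset_target := subset_univ _
  isFlowInvariant_source := isFlowInvariant_univ _
  isFlowInvariant_target := isFlowInvariant_univ _
  isImage_doc := fun _ _ ↦ Iff.rfl
  isImage_horizon := fun _ _ ↦ Iff.rfl
  pullbackBilin_eq x _ := by
    rw [one_pow, one_smul]
    exact congrFun (pullbackBilin_id (I := 𝓡 4) 𝓑.metric.val) x
  mfderiv_killing x _ := by
    change mfderiv (𝓡 4) (𝓡 4) id x (𝓑.killing x) = (1 : ℝ) • 𝓑.killing x
    rw [mfderiv_id, one_smul]
    rfl
  isFutureDirected x _ := by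
    change 𝓑.timeOrientation.IsFutureDirected
      (mfderiv (𝓡 4) (𝓡 4) id x (𝓑.timeOrientation.vectorField x))
    rw [mfderiv_id]
    exact 𝓑.timeOrientation.isFutureDirected_vectorField x

/-- The inverse differential: `dψ (dψ⁻¹ w) = w` for `y ∈ U'`, `w ∈ T_y M'`. [folklore] -/
theorem mfderiv_mfderiv_symm {y : 𝓑'.carrier} (hy : y ∈ h.toOpenPartialHomeomorph.target)
    (w : TangentSpace (𝓡 4) y) :
    mfderiv (𝓡 4) (𝓡 4) h.toOpenPartialHomeomorph (h.toOpenPartialHomeomorph.symm y)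
      (mfderiv (𝓡 4) (𝓡 4) h.toOpenPartialHomeomorph.symm y w) = w := by
  have := h.mdifferentiable.comp_symm_deriv hy
  exact congrArg (fun L : TangentSpace (𝓡 4) y →L[ℝ] TangentSpace (𝓡 4) y ↦ L w) this

/-- `(ψ⁻¹)^* g = λ⁻² g'` on `U'`: `g(dψ⁻¹ v, dψ⁻¹ w) = λ⁻² g'(v, w)`. [folklore] -/
theorem val_mfderiv_symm_mfderiv_symm {y : 𝓑'.carrier} (hy : y ∈ h.toOpenPartialHomeomorph.target)
    (v w : TangentSpace (𝓡 4) y) :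
    𝓑.metric.val (h.toOpenPartialHomeomorph.symm y)
        (mfderiv (𝓡 4) (𝓡 4) h.toOpenPartialHomeomorph.symm y v)
        (mfderiv (𝓡 4) (𝓡 4) h.toOpenPartialHomeomorph.symm y w) =
      (h.scale ^ 2)⁻¹ * 𝓑'.metric.val y v w := by
  have hx : h.toOpenPartialHomeomorph.symm y ∈ h.toOpenPartialHomeomorph.source :=
    h.toOpenPartialHomeomorph.map_target hy
  have key := h.val_mfderiv_mfderiv hx
    (mfderiv (𝓡 4) (𝓡 4) h.toOpenPartialHomeomorph.symm y v)
    (mfderiv (𝓡 4) (𝓡 4) h.toOpenPartialHomeomorph.symm y w)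
  rw [h.mfderiv_mfderiv_symm hy, h.mfderiv_mfderiv_symm hy,
    h.toOpenPartialHomeomorph.right_inv hy] at key
  rw [key, ← mul_assoc, inv_mul_cancel₀ (pow_ne_zero 2 h.scale_pos.ne'), one_mul]

/-- `dψ⁻¹ T' = λ⁻¹ T ∘ ψ⁻¹` on `U'`. [folklore] -/
theorem mfderiv_symm_killing {y : 𝓑'.carrier} (hy : y ∈ h.toOpenPartialHomeomorph.target) :
    mfderiv (𝓡 4) (𝓡 4) h.toOpenPartialHomeomorph.symm y (𝓑'.killing y) =
      h.scale⁻¹ • 𝓑.killing (h.toOpenPartialHomeomorph.symm y) := by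
  have hx : h.toOpenPartialHomeomorph.symm y ∈ h.toOpenPartialHomeomorph.source :=
    h.toOpenPartialHomeomorph.map_target hy
  -- `dψ (dψ⁻¹ T') = T' = dψ (λ⁻¹ T)`, and `dψ` is injective
  refine h.mdifferentiable.mfderiv_injective hx ?_
  rw [map_smul, h.mfderiv_killing _ hx, smul_smul, inv_mul_cancel₀ h.scale_pos.ne', one_smul]
  refine (h.mfderiv_mfderiv_symm hy _).trans ?_
  exact (𝓑'.killing_congr (h.toOpenPartialHomeomorph.right_inv hy)).symm

/-- `dψ⁻¹` maps the time orientation of `M'` at `y ∈ U'` to a future-directed vector at `ψ⁻¹ y`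
(a scaled linear isometry mapping one future-directed timelike vector into the future cone maps
the whole future cone into the future cone; O'Neill 1983, Ch. 5, Lemma 5.29). [folklore] -/
theorem isFutureDirected_mfderiv_symm {y : 𝓑'.carrier}
    (hy : y ∈ h.toOpenPartialHomeomorph.target) :
    𝓑.timeOrientation.IsFutureDirected
      (mfderiv (𝓡 4) (𝓡 4) h.toOpenPartialHomeomorph.symm y
        (𝓑'.timeOrientation.vectorField y)) := by
  have hx : h.toOpenPartialHomeomorph.symm y ∈ h.toOpenPartialHomeomorph.source :=
    h.toOpenPartialHomeomorph.map_target hy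
  have hs2 : 0 < (h.scale ^ 2)⁻¹ := inv_pos.2 (pow_pos h.scale_pos 2)
  -- `g(u, u) = λ⁻² g'(τ', τ') < 0` for `u = dψ⁻¹ τ'`
  have huu : 𝓑.metric.val (h.toOpenPartialHomeomorph.symm y)
      (mfderiv (𝓡 4) (𝓡 4) h.toOpenPartialHomeomorph.symm y (𝓑'.timeOrientation.vectorField y))
      (mfderiv (𝓡 4) (𝓡 4) h.toOpenPartialHomeomorph.symm y (𝓑'.timeOrientation.vectorField y))
        < 0 := by
    rw [h.val_mfderiv_symm_mfderiv_symm hy]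
    exact mul_neg_of_pos_of_neg hs2 (𝓑'.timeOrientation.isTimelike y)
  -- `λ² g(τ, u) = g'(dψ τ, τ') < 0` since `dψ τ` is future-directed at `y`
  have hfd := (h.isFutureDirected _ hx).2
  rw [h.toOpenPartialHomeomorph.right_inv hy] at hfd
  have hτu := h.val_mfderiv_mfderiv hx
    (𝓑.timeOrientation.vectorField (h.toOpenPartialHomeomorph.symm y))
    (mfderiv (𝓡 4) (𝓡 4) h.toOpenPartialHomeomorph.symm y (𝓑'.timeOrientation.vectorField y))
  rw [h.mfderiv_mfderiv_symm hy, h.toOpenPartialHomeomorph.right_inv hy, 𝓑'.metric.symm] at hτu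
  have hs2' : 0 < h.scale ^ 2 := pow_pos h.scale_pos 2
  refine ⟨⟨huu.le, fun h0 ↦ ?_⟩, ?_⟩
  · simp [h0] at huu
  · by_contra hcon
    push Not at hcon
    have : 0 ≤ h.scale ^ 2 * 𝓑.metric.val (h.toOpenPartialHomeomorph.symm y)
        (𝓑.timeOrientation.vectorField (h.toOpenPartialHomeomorph.symm y))
        (mfderiv (𝓡 4) (𝓡 4) h.toOpenPartialHomeomorph.symm y
          (𝓑'.timeOrientation.vectorField y)) := mul_nonneg hs2'.le hcon
    linarith

/-- **Symmetry**: the inverse homeomorphism `ψ⁻¹ : U' → U` with scale `λ⁻¹`. [folklore] -/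
def symm : ModuliEquivalence 𝓑' 𝓑 where
  toOpenPartialHomeomorph := h.toOpenPartialHomeomorph.symm
  scale := h.scale⁻¹
  scale_pos := inv_pos.2 h.scale_pos
  contMDiffOn := h.contMDiffOn_symm
  contMDiffOn_symm := h.contMDiffOn
  doc_union_horizon_subset_source := h.doc_union_horizon_subset_target
  doc_union_horizon_subset_target := h.doc_union_horizon_subset_source
  isFlowInvariant_source := h.isFlowInvariant_target
  isFlowInvariant_target := h.isFlowInvariant_source
  isImage_doc := h.isImage_doc.symm
  isImage_horizon := h.isImage_horizon.symm
  pullbackBilin_eq y hy := by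
    ext v w
    rw [pullbackBilin_apply, smul_apply, smul_apply, smul_eq_mul, inv_pow]
    exact h.val_mfderiv_symm_mfderiv_symm hy v w
  mfderiv_killing y hy := h.mfderiv_symm_killing hy
  isFutureDirected y hy := h.isFutureDirected_mfderiv_symm hy

/-- The scale of `h.symm` is `λ⁻¹`. [folklore] -/
@[simp]
theorem scale_symm : h.symm.scale = h.scale⁻¹ :=
  rfl

/-- The homeomorphism of `h.symm` is `ψ⁻¹`. [folklore] -/
@[simp]
theorem toOpenPartialHomeomorph_symm :
    h.symm.toOpenPartialHomeomorph = h.toOpenPartialHomeomorph.symm :=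
  rfl

/-- **An equivalence maps `T`-orbits to reparametrised `T'`-orbits**: if `γ` is a whole-line
integral curve of `T` starting in `U`, then `t ↦ ψ (γ (t/λ))` is a whole-line integral curve of
`T'` (chain rule `d(ψ ∘ γ)/dt = dψ T = λ T'`, and `IsMIntegralCurve.comp_mul`). [folklore] -/
theorem isMIntegralCurve_comp {γ : ℝ → 𝓑.carrier} (hγ : IsMIntegralCurve γ 𝓑.killing)
    (h0 : γ 0 ∈ h.toOpenPartialHomeomorph.source) :
    IsMIntegralCurve (h.toOpenPartialHomeomorph ∘ γ ∘ (· * h.scale⁻¹)) 𝓑'.killing := by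
  have hmem : ∀ t, γ t ∈ h.toOpenPartialHomeomorph.source := h.isFlowInvariant_source γ hγ h0
  -- `ψ ∘ γ` is an integral curve of `λ T'`
  have h1 : IsMIntegralCurve (h.toOpenPartialHomeomorph ∘ γ) (h.scale • 𝓑'.killing) := by
    intro t
    have hψ : HasMFDerivAt (𝓡 4) (𝓡 4) h.toOpenPartialHomeomorph (γ t)
        (mfderiv (𝓡 4) (𝓡 4) h.toOpenPartialHomeomorph (γ t)) :=
      (h.mdifferentiable.mdifferentiableAt (hmem t)).hasMFDerivAt
    have hc := hψ.comp t (hγ t)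
    have heq : (mfderiv (𝓡 4) (𝓡 4) h.toOpenPartialHomeomorph (γ t)).comp
        ((1 : ℝ →L[ℝ] ℝ).smulRight (𝓑.killing (γ t))) =
        (1 : ℝ →L[ℝ] ℝ).smulRight ((h.scale • 𝓑'.killing) ((h.toOpenPartialHomeomorph ∘ γ) t)) := by
      apply ContinuousLinearMap.ext_ring
      change mfderiv (𝓡 4) (𝓡 4) h.toOpenPartialHomeomorph (γ t) ((1 : ℝ) • 𝓑.killing (γ t)) =
        (1 : ℝ) • (h.scale • 𝓑'.killing (h.toOpenPartialHomeomorph (γ t)))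
      rw [one_smul, one_smul, h.mfderiv_killing (γ t) (hmem t)]
    exact heq ▸ hc
  have h2 := h1.comp_mul h.scale⁻¹
  rwa [smul_smul, inv_mul_cancel₀ h.scale_pos.ne', one_smul] at h2

/-- Chain rule for the composite of two equivalences: `d(ψ' ∘ ψ)_x v = dψ'_{ψ x} (dψ_x v)` on
`U ∩ ψ⁻¹(V)`. [folklore] -/
theorem mfderiv_trans_apply (h' : ModuliEquivalence 𝓑' 𝓑'') {x : 𝓑.carrier}
    (hx : x ∈ h.toOpenPartialHomeomorph.source)
    (hx' : h.toOpenPartialHomeomorph x ∈ h'.toOpenPartialHomeomorph.source)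
    (v : TangentSpace (𝓡 4) x) :
    mfderiv (𝓡 4) (𝓡 4) (h.toOpenPartialHomeomorph.trans h'.toOpenPartialHomeomorph) x v =
      mfderiv (𝓡 4) (𝓡 4) h'.toOpenPartialHomeomorph (h.toOpenPartialHomeomorph x)
        (mfderiv (𝓡 4) (𝓡 4) h.toOpenPartialHomeomorph x v) := by
  rw [OpenPartialHomeomorph.coe_trans, mfderiv_comp x (h'.mdifferentiable.mdifferentiableAt hx')
    (h.mdifferentiable.mdifferentiableAt hx)]
  rfl

/-- **Transitivity**: composition of the homeomorphisms (on `U ∩ ψ⁻¹(V)`), product of the scales.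
The composite source is `T`-invariant because `ψ` maps `T`-orbits to `T'`-orbits
(`isMIntegralCurve_comp`) and `V` is `T'`-invariant; dually for the target. [folklore] -/
def trans (h' : ModuliEquivalence 𝓑' 𝓑'') : ModuliEquivalence 𝓑 𝓑'' where
  toOpenPartialHomeomorph := h.toOpenPartialHomeomorph.trans h'.toOpenPartialHomeomorph
  scale := h.scale * h'.scale
  scale_pos := mul_pos h.scale_pos h'.scale_pos
  contMDiffOn := by
    rw [OpenPartialHomeomorph.trans_source, OpenPartialHomeomorph.coe_trans]
    exact h'.contMDiffOn.comp (h.contMDiffOn.mono inter_subset_left)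
      fun x hx ↦ hx.2
  contMDiffOn_symm := by
    rw [OpenPartialHomeomorph.trans_target, OpenPartialHomeomorph.coe_trans_symm]
    exact h.contMDiffOn_symm.comp (h'.contMDiffOn_symm.mono inter_subset_left)
      fun y hy ↦ hy.2
  doc_union_horizon_subset_source := by
    rw [OpenPartialHomeomorph.trans_source]
    intro x hx
    have hxU := h.doc_union_horizon_subset_source hx
    refine ⟨hxU, ?_⟩
    change h.toOpenPartialHomeomorph x ∈ h'.toOpenPartialHomeomorph.source
    refine h'.doc_union_horizon_subset_source ?_
    rcases hx with hx | hx
    · exact Or.inl ((h.isImage_doc hxU).2 hx)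
    · exact Or.inr ((h.isImage_horizon hxU).2 hx)
  doc_union_horizon_subset_target := by
    rw [OpenPartialHomeomorph.trans_target]
    intro y hy
    have hyV := h'.doc_union_horizon_subset_target hy
    refine ⟨hyV, ?_⟩
    change h'.toOpenPartialHomeomorph.symm y ∈ h.toOpenPartialHomeomorph.target
    refine h.doc_union_horizon_subset_target ?_
    rcases hy with hy | hy
    · exact Or.inl ((h'.isImage_doc.symm hyV).2 hy)
    · exact Or.inr ((h'.isImage_horizon.symm hyV).2 hy)
  isFlowInvariant_source := by
    rw [OpenPartialHomeomorph.trans_source]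
    intro γ hγ h0 t
    refine ⟨h.isFlowInvariant_source γ hγ h0.1 t, ?_⟩
    have hδ := h.isMIntegralCurve_comp hγ h0.1
    have hδ0 : (h.toOpenPartialHomeomorph ∘ γ ∘ (· * h.scale⁻¹)) 0 ∈
        h'.toOpenPartialHomeomorph.source := by simpa using h0.2
    have := h'.isFlowInvariant_source _ hδ hδ0 (t * h.scale)
    simpa [mul_assoc, mul_inv_cancel₀ h.scale_pos.ne'] using this
  isFlowInvariant_target := by
    rw [OpenPartialHomeomorph.trans_target]
    intro γ hγ h0 t
    refine ⟨h'.isFlowInvariant_target γ hγ h0.1 t, ?_⟩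
    have hδ := h'.symm.isMIntegralCurve_comp hγ h0.1
    have hδ0 : (h'.symm.toOpenPartialHomeomorph ∘ γ ∘ (· * h'.symm.scale⁻¹)) 0 ∈
        h.toOpenPartialHomeomorph.target := by simpa [ModuliEquivalence.symm] using h0.2
    have := h.isFlowInvariant_target _ hδ hδ0 (t * h'.symm.scale)
    simpa [ModuliEquivalence.symm, mul_assoc, inv_mul_cancel₀ h'.scale_pos.ne'] using this
  isImage_doc := fun x hx ↦ by
    rw [OpenPartialHomeomorph.trans_source] at hx
    rw [OpenPartialHomeomorph.coe_trans, Function.comp_apply, h'.isImage_doc hx.2,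
      h.isImage_doc hx.1]
  isImage_horizon := fun x hx ↦ by
    rw [OpenPartialHomeomorph.trans_source] at hx
    rw [OpenPartialHomeomorph.coe_trans, Function.comp_apply, h'.isImage_horizon hx.2,
      h.isImage_horizon hx.1]
  pullbackBilin_eq x hx := by
    rw [OpenPartialHomeomorph.trans_source] at hx
    ext v w
    rw [pullbackBilin_apply, h.mfderiv_trans_apply h' hx.1 hx.2, h.mfderiv_trans_apply h' hx.1 hx.2,
      OpenPartialHomeomorph.coe_trans, Function.comp_apply, h'.val_mfderiv_mfderiv hx.2,
      h.val_mfderiv_mfderiv hx.1, smul_apply, smul_apply, smul_eq_mul]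
    ring
  mfderiv_killing x hx := by
    rw [OpenPartialHomeomorph.trans_source] at hx
    rw [h.mfderiv_trans_apply h' hx.1 hx.2, h.mfderiv_killing x hx.1, map_smul,
      h'.mfderiv_killing _ hx.2, smul_smul, mul_comm, OpenPartialHomeomorph.coe_trans,
      Function.comp_apply]
  isFutureDirected x hx := by
    rw [OpenPartialHomeomorph.trans_source] at hx
    rw [h.mfderiv_trans_apply h' hx.1 hx.2, OpenPartialHomeomorph.coe_trans, Function.comp_apply]
    -- `u := dψ τ_x` is future-directed at `y = ψ x`; `A := dψ'_y` is a scaled isometry mapping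
    -- `τ'_y` into the future cone at `ψ' y`, hence maps `u` into it (O'Neill 1983, Lemma 5.29).
    have hu : 𝓑'.timeOrientation.IsFutureDirected (mfderiv (𝓡 4) (𝓡 4) h.toOpenPartialHomeomorph
        x (𝓑.timeOrientation.vectorField x)) := h.isFutureDirected x hx.1
    have hAτ := h'.isFutureDirected _ hx.2
    have hs2 : 0 < h'.scale ^ 2 := pow_pos h'.scale_pos 2
    refine 𝓑''.timeOrientation.isFutureDirected_of_val_lt_zero hAτ ?_ ?_ ?_
    · -- `A τ'` is timelike
      change 𝓑''.metric.val _ _ _ < 0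
      rw [h'.val_mfderiv_mfderiv hx.2]
      exact mul_neg_of_pos_of_neg hs2 (𝓑'.timeOrientation.isTimelike _)
    · -- `A u` is causal
      refine ⟨?_, fun h0 ↦ ?_⟩
      · rw [h'.val_mfderiv_mfderiv hx.2]
        exact mul_nonpos_of_nonneg_of_nonpos hs2.le hu.1.1
      · have := h'.val_mfderiv_mfderiv hx.2
          (𝓑'.timeOrientation.vectorField (h.toOpenPartialHomeomorph x))
          (mfderiv (𝓡 4) (𝓡 4) h.toOpenPartialHomeomorph x (𝓑.timeOrientation.vectorField x))
        rw [h0, map_zero] at this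
        have hneg := mul_neg_of_pos_of_neg hs2 hu.2
        linarith
    · -- `g''(A τ', A u) = λ'² g'(τ', u) < 0`
      rw [h'.val_mfderiv_mfderiv hx.2]
      exact mul_neg_of_pos_of_neg hs2 hu.2

/-- The scale of `h.trans h'` is `λ λ'`. [folklore] -/
@[simp]
theorem scale_trans (h' : ModuliEquivalence 𝓑' 𝓑'') : (h.trans h').scale = h.scale * h'.scale :=
  rfl

end ModuliEquivalence

/-! ### The equivalence relation and the moduli space -/

/-- Two stationary black holes are **equivalent modulo isometry and homothety** if there is a
`ModuliEquivalence` between them (an isometry-composed-with-homothety of `T`-invariant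
neighbourhoods of `⟨⟨M_ext⟩⟩ ∪ 𝓔⁺` intertwining the normalised Killing fields and identifying the
d.o.c.s and the horizons). An equivalence relation (`isModuliEquivalent_equivalence`).
[folklore] -/
def IsModuliEquivalent (𝓑 𝓑' : StationaryAFBlackHole.{u}) : Prop :=
  Nonempty (ModuliEquivalence 𝓑 𝓑')

/-- `IsModuliEquivalent` is reflexive. [folklore] -/
theorem IsModuliEquivalent.refl (𝓑 : StationaryAFBlackHole.{u}) : IsModuliEquivalent 𝓑 𝓑 :=
  ⟨ModuliEquivalence.refl 𝓑⟩

/-- `IsModuliEquivalent` is symmetric. [folklore] -/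
theorem IsModuliEquivalent.symm {𝓑 𝓑' : StationaryAFBlackHole.{u}} (h : IsModuliEquivalent 𝓑 𝓑') :
    IsModuliEquivalent 𝓑' 𝓑 :=
  h.map ModuliEquivalence.symm

/-- `IsModuliEquivalent` is transitive. [folklore] -/
theorem IsModuliEquivalent.trans {𝓑 𝓑' 𝓑'' : StationaryAFBlackHole.{u}}
    (h : IsModuliEquivalent 𝓑 𝓑') (h' : IsModuliEquivalent 𝓑' 𝓑'') : IsModuliEquivalent 𝓑 𝓑'' :=
  let ⟨e⟩ := h; let ⟨e'⟩ := h'; ⟨e.trans e'⟩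

/-- `IsModuliEquivalent` is an equivalence relation on stationary black holes. [folklore] -/
theorem isModuliEquivalent_equivalence :
    _root_.Equivalence (IsModuliEquivalent : StationaryAFBlackHole.{u} → _ → Prop) :=
  ⟨IsModuliEquivalent.refl, IsModuliEquivalent.symm, IsModuliEquivalent.trans⟩

/-- Equivalent black holes have the same level. [folklore] -/
theorem IsModuliEquivalent.level_eq {𝓑 𝓑' : StationaryAFBlackHole.{u}}
    (h : IsModuliEquivalent 𝓑 𝓑') : 𝓑.level = 𝓑'.level :=
  let ⟨e⟩ := h; e.level_eq

end StationaryAFBlackHole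

/-- The type of **regular stationary vacuum black holes**: stationary AF black holes
(`StationaryAFBlackHole`) satisfying `IsRegularVacuum` (globally hyperbolic carrier with the slice
a Cauchy hypersurface, connected non-degenerate future event horizon, normalised stationary Killing
field, `Ric(g) = 0`). The setoid `IsModuliEquivalent` on it defines the moduli space. [folklore] -/
def RegularStationaryVacuumBlackHole : Type (u + 1) :=
  {𝓑 : StationaryAFBlackHole.{u} // 𝓑.IsRegularVacuum}

namespace RegularStationaryVacuumBlackHole

/-- The moduli-space setoid on regular stationary vacuum black holes: equivalence modulo
isometry of `T`-invariant neighbourhoods of `⟨⟨M_ext⟩⟩ ∪ 𝓔⁺` intertwining the Killing fields,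
composed with homotheties (`StationaryAFBlackHole.IsModuliEquivalent`). [folklore] -/
instance setoid : Setoid RegularStationaryVacuumBlackHole.{u} where
  r 𝓑 𝓑' := 𝓑.1.IsModuliEquivalent 𝓑'.1
  iseqv := ⟨fun 𝓑 ↦ StationaryAFBlackHole.IsModuliEquivalent.refl 𝓑.1,
    StationaryAFBlackHole.IsModuliEquivalent.symm, StationaryAFBlackHole.IsModuliEquivalent.trans⟩

/-- Unfolding lemma for the setoid relation. [folklore] -/
theorem equiv_iff (𝓑 𝓑' : RegularStationaryVacuumBlackHole.{u}) :
    𝓑 ≈ 𝓑' ↔ 𝓑.1.IsModuliEquivalent 𝓑'.1 :=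
  Iff.rfl

end RegularStationaryVacuumBlackHole

/-- The **moduli space of regular stationary vacuum black holes** `𝔐` (definition request
`defn-StationaryVacuumModuli` of route `FinalStateConjecture/SignedCensus`, the layer-2 object of
its items `OpenUnderRotation`, `ClosedUnderRotation`, `CensusUniqueness`): the quotient of the
regular stationary vacuum black holes (`RegularStationaryVacuumBlackHole`: smooth — no analyticity,
axisymmetry or closeness to Kerr — stationary AF vacuum spacetimes, globally hyperbolic with the
slice a Cauchy hypersurface, with connected non-degenerate future event horizon and stationary Killing field
normalised at infinity) by equivalence modulo isometry of `T`-invariant neighbourhoods of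
`⟨⟨M_ext⟩⟩ ∪ 𝓔⁺` intertwining the Killing fields, composed with homotheties `g ↦ λ² g`
(`StationaryAFBlackHole.ModuliEquivalence`). It lives in `Type (u+1)` (its points are classes of
structures carrying a `Type u`). Its topology (pointed `C^∞` Cheeger–Gromov convergence plus
uniform asymptotic flatness) is `StationaryVacuumModuliTopology`; the level map is
`StationaryVacuumModuli.level`. Model: the moduli spaces of static/stationary vacuum metrics
modulo diffeomorphisms of Anderson (Ann. Henri Poincaré 1 (2000), §1) and Anderson–Khuri
(arXiv:0909.4550, §2), here for black-hole exteriors-with-horizon of varying underlying manifold.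
No claim is made here that `𝔐` is nonempty (that sub-extremal Kerr, with a horizon-crossing
Cauchy slice, is a point of it is the route's "cheapest falsifier (i)", a theorem to be proved
about `Kerr.stationaryAFBlackHole`, not part of this definition). [folklore] -/
def StationaryVacuumModuli : Type (u + 1) :=
  Quotient (RegularStationaryVacuumBlackHole.setoid.{u})

namespace StationaryVacuumModuli

/-- The class `[𝓑] ∈ 𝔐` of a regular stationary vacuum black hole. [folklore] -/
def mk (𝓑 : StationaryAFBlackHole.{u}) (h𝓑 : 𝓑.IsRegularVacuum) : StationaryVacuumModuli.{u} :=
  Quotient.mk _ ⟨𝓑, h𝓑⟩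

/-- Two regular black holes define the same point of `𝔐` iff they are equivalent modulo isometry
and homothety (`Quotient.eq`). [folklore] -/
theorem mk_eq_mk_iff {𝓑 𝓑' : StationaryAFBlackHole.{u}} (h𝓑 : 𝓑.IsRegularVacuum)
    (h𝓑' : 𝓑'.IsRegularVacuum) :
    mk 𝓑 h𝓑 = mk 𝓑' h𝓑' ↔ 𝓑.IsModuliEquivalent 𝓑' :=
  Quotient.eq

/-- A `ModuliEquivalence` identifies the classes. [folklore] -/
theorem mk_eq_mk_of_moduliEquivalence {𝓑 𝓑' : StationaryAFBlackHole.{u}} (h𝓑 : 𝓑.IsRegularVacuum)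
    (h𝓑' : 𝓑'.IsRegularVacuum) (e : 𝓑.ModuliEquivalence 𝓑') : mk 𝓑 h𝓑 = mk 𝓑' h𝓑' :=
  (mk_eq_mk_iff h𝓑 h𝓑').2 ⟨e⟩

/-- Every point of `𝔐` is the class of a regular stationary vacuum black hole (induction
principle, `Quotient.ind`). [folklore] -/
@[elab_as_elim]
theorem ind {P : StationaryVacuumModuli.{u} → Prop}
    (h : ∀ (𝓑 : StationaryAFBlackHole.{u}) (h𝓑 : 𝓑.IsRegularVacuum), P (mk 𝓑 h𝓑))
    (m : StationaryVacuumModuli.{u}) : P m :=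
  Quotient.ind (fun 𝓑 ↦ h 𝓑.1 𝓑.2) m

/-- Every point of `𝔐` has a representative. [folklore] -/
theorem exists_rep (m : StationaryVacuumModuli.{u}) :
    ∃ (𝓑 : StationaryAFBlackHole.{u}) (h𝓑 : 𝓑.IsRegularVacuum), mk 𝓑 h𝓑 = m := by
  induction m using ind with
  | h 𝓑 h𝓑 => exact ⟨𝓑, h𝓑, rfl⟩

/-- The **level map** `s : 𝔐 → ℝ`, `s[𝓑] = sup_{𝓔⁺} g(T, T)` (`StationaryAFBlackHole.level`),
well defined on classes by `ModuliEquivalence.level_eq` (`Quotient.lift`). It grades route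
`FinalStateConjecture/SignedCensus` (no-hair up to level `s`); along the Kerr family it is
`a²/r₊² ∈ [0, 1)` (cf. Alexakis–Ionescu–Klainerman 2014, Thm. 1.1, whose smallness parameter is
`‖g(T,T)‖_{L^∞(S₀)}`). Values: in `[0, ∞)` on classes whose horizon values of `g(T,T)` are nonnegative and
bounded (junk `0` otherwise, see `StationaryAFBlackHole.level`); continuity of `level` for the
moduli topology is NOT asserted here. [cite: AlexakisIonescuKlainerman2014, Thm. 1.1] -/
def level : StationaryVacuumModuli.{u} → ℝ :=
  Quotient.lift (fun 𝓑 : RegularStationaryVacuumBlackHole.{u} ↦ 𝓑.1.level)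
    fun _ _ h ↦ StationaryAFBlackHole.IsModuliEquivalent.level_eq h

/-- The level of a class is the level of any representative (by `rfl`). [folklore] -/
@[simp]
theorem level_mk (𝓑 : StationaryAFBlackHole.{u}) (h𝓑 : 𝓑.IsRegularVacuum) :
    level (mk 𝓑 h𝓑) = 𝓑.level :=
  rfl

/-- The sublevel set `{level ≤ s} ⊆ 𝔐` — the classes of holes with horizon rotation level at most
`s`, over which route `FinalStateConjecture/SignedCensus` runs its induction. [folklore] -/
def sublevel (s : ℝ) : Set StationaryVacuumModuli.{u} :=
  {m | level m ≤ s}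

/-- Membership in a sublevel set. [folklore] -/
@[simp]
theorem mem_sublevel_iff {s : ℝ} {m : StationaryVacuumModuli.{u}} : m ∈ sublevel s ↔ level m ≤ s :=
  Iff.rfl

/-- The sublevel sets increase with the level. [folklore] -/
theorem sublevel_mono {s s' : ℝ} (h : s ≤ s') : sublevel.{u} s ⊆ sublevel s' :=
  fun _ hm ↦ le_trans hm h

end StationaryVacuumModuli

end Literature.Geometry.Lorentzian

end
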